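import Literature.AlgebraicGeometry.HodgeTheory.SymplecticHodgeGroupPowersHodgeClasses
import Literature.AlgebraicGeometry.HodgeTheory.CodimTwoDivisorWeilGenerated
import Literature.AlgebraicGeometry.HodgeTheory.BettiHodgeConjectureStandardASmallDimensions
import Literature.AlgebraicGeometry.Motives.HodgeLieWeightOneRankEightMumfordNormalForm
import Literature.RepresentationTheory.GeneralLinear.SL2TripleCubeBasis
import HarnessLib

/-!
# `B²(X) = D²(X)` and the Hodge conjecture for EVERY complex abelian fourfold with `End⁰(X) = ℚ`
# (Moonen–Zarhin 1999 Thm. (0.1)(3): «Then the Hodge ring `B•(X)` is generated by divisor classes»), the Mumford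
# branch `Hg(X) ≃ ℚ`-form of `SL₂ × SL₂ × SL₂` included

Family `hodge`, layer `Literature/AlgebraicGeometry/HodgeTheory`.  Research context: cell `pub-hodge-ring2` (HONEST FRAMING
of that cell: research route conditional on HC_CM; not a corollary; Q11.4-sentence-2 already refuted in dim ≥ 3), Literature
lane gen 73, programme R50.  THIS FILE IS UNCONDITIONAL: theorems only, no definition, no named fact (D-0026), no `sorry`,
no `HC_CM`, no Markman; the real Hodge model and the `(p,q)`-independence are the tree's HYPOTHESES `exists_isReal_hodgeModel`,
`hodgePQ_independent_of_hodgeModel` of every theorem of this layer (theorems `…_holds` of the summit layer).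

THE PRINT.  B. Moonen, Yu. Zarhin, *Hodge classes on abelian varieties of low dimension*, Math. Ann. **315** (1999), Thm. (0.1)(3)
[held text `paper:arxiv-math_9901113` p. 1, L112–118]: «Suppose we are in case (d) [`X` simple of dimension 4 with `End⁰(X) = ℚ`].
Then the Hodge ring `B•(X)` is generated by divisor classes, i.e., `B•(X) = D•(X)`.  Either `Hg(X) = Sp(V,φ)` … or `Hg(X)` is
isogenous to a `ℚ`-form of `SL₂ × SL₂ × SL₂` …»; §2 (2.5)(1) [p. 5, L142–148]: «if `g = 4` and `End⁰(X) = ℚ` then either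
`Hg(X) = Sp(V,φ) ≅ Sp_{8,ℚ}`, or `Hg(X)` is a `ℚ`-form of an almost direct product of three copies of `SL₂` … `V_ℂ` the product of
the standard representations … In both cases the Hodge ring of `X` is generated by divisor classes» (Moonen–Zarhin 1995 §2, type
I(1); the second case occurs: Mumford 1969 §4).  The computation behind «in both cases»: for `V_ℂ = 2 ⊠ 2 ⊠ 2` the invariants of
`SL₂³` in `⋀⁴ V_ℂ ⊂ V_ℂ^{⊗4}` form the line `ℂ φ²` — the invariants of one `SL₂` on `(ℂ²)^{⊗4}` are spanned by the two pairings
`ε₀₁ε₂₃`, `ε₀₂ε₁₃` (Plücker: `ε₀₂ε₁₃ = ε₀₁ε₂₃ + ε₀₃ε₁₂`), and alternation collapses the `2³` products of pairings to `φ ⊗ φ`.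

THIS FILE.
* §0 **`HodgeStructure.wordDerAt_eq_zero_of_mem_hodgeLieC`** — THEOREM L-Hg, any rank and weight: a rational coefficient tensor
  killed (slice by slice, diagonally) by a Hodge operator `Θ` is killed by EVERY `Y ∈ Lie Hg(H) ⊗ ℂ` (the rational annihilator
  `𝔞` is bracket-closed with `Θ ∈ 𝔞_ℂ`, so `Lie Hg ≤ 𝔞` by Deligne rigidity `hodgeLie_rigid`).
* §1 (pure combinatorics over a field of characteristic zero) **`SL2Cube.oneColour`** — a function on binary words of length `4`
  of `H`-weight zero and killed by the raising derivation is `t(0101)·ε₀₁ε₂₃ + t(0011)·ε₀₂ε₁₃`; **`SL2Cube.threeColour`** — the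
  `2³`-term expansion of a function on words in the cube `(Fin 3 → Fin 2)` killed colourwise.
* §2 **`mem_divisorClassesSpan_two_of_sl2Triples`** — for a complex abelian variety `X` whose `Lie Hg(H¹(X)) ⊗ ℂ`
  CONTAINS three pairwise commuting standard `𝔰𝔩₂`-triples on `H¹(X;ℚ) ⊗ ℂ` (`dim = 8`), the first `H` being a Hodge operator:
  every rational `(2,2)`-class of `X` lies in `D²(X) ⊗ ℂ`.  PROOF: the cube basis `b_x` of `SL2Triple.exists_cubeBasis` is a basis
  of pure Hodge types with `ψ_ℂ`-Gram matrix `c₀ · ε^{⊗3}`; the antisymmetric kind-balanced coefficient function of the class in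
  the letters `b_x` (`AVSlots.exists_antisymm_kindBalanced_wordEval_eq`) is killed by the matrices of all nine operators (§0 and
  the transport of `AVSlots.exists_symplecticInvariant_coeff_of_sp`), hence (§1) is a combination of the eight products of
  pairings, each of which evaluates (alternation, Plücker) to a rational multiple of `φ' ⌣ φ'`, `φ' = ∑ ε^{⊗3}_{xy} b_x ⌣ b_y =
  c₀ · Λ_ψ(1)` a rational `(1,1)`-class (`casimirClass`).
* §3 **`mem_divisorClassesSpan_two_of_finrank_endAlgebra_eq_one_of_dim_eq_four`**,
  **`isDivisorGenerated_of_finrank_endAlgebra_eq_one_of_dim_eq_four`** (`B•(X) = D•(X) ⊗ ℂ` in ALL codimensions, by hard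
  Lefschetz), **`isCodimTwoDivisorWeilGenerated_of_finrank_endAlgebra_eq_one_of_dim_eq_four`**,
  **`hodgeConjectureFor_of_finrank_endAlgebra_eq_one_of_dim_eq_four`** — for EVERY complex abelian fourfold with
  `finrank_ℚ End⁰(X) = 1`: `B²(X) ⊆ D²(X) ⊗ ℂ` and the Hodge conjecture for `X`, UNCONDITIONALLY (the symplectic branch of
  `HodgeStructure.hodgeLieC_rankEight_dichotomy` is `AVSlots.isDivisorGenerated_of_hodgeLieC_sp`; the Mumford branch is §2 fed by
  `HodgeStructure.exists_mumford_normalForm`; `HC(X) ⟺ HC²(X)` for a fourfold).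

WHAT IS NOT CLAIMED: nothing about `X²` (MZ99: the Mumford branch carries exceptional Hodge classes in `B²(X²)`); nothing about
fourfolds with larger endomorphism algebra; nothing about powers `Xⁿ` (the Sp branch has them, `AVSlots.isDivisorGenerated_of_hodgeLieC_sp`;
the Mumford branch does not).

## References

* [MoonenZarhin1999LowDim] B. Moonen, Yu. Zarhin, Math. Ann. 315 (1999), Thm. (0.1)(3), §1 (1.8), §2 (2.3), (2.5)(1), §3 (3.1).
* [MoonenZarhin1995Duke] B. Moonen, Yu. Zarhin, Duke Math. J. 77 (1995), §2 (type I(1)).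
* [Mumford1969NoteShimura] D. Mumford, Math. Ann. 181 (1969), §4.
* [Deligne1982HodgeCycles] P. Deligne, LNM 900 (1982), I §3 Prop. 3.4, 3.6.
* [Milne1999LefschetzClasses] J. S. Milne, Duke Math. J. 96 (1999), Prop. 3.3, Prop. 3.6 (a), Remark 3.7.
* [GoodmanWallachGTM255] R. Goodman, N. R. Wallach, GTM 255 (2009), §4.1.1, Thm. 5.3.5, §5.5 (tensor invariants of `SL₂`).
* [FultonHarris1991] W. Fulton, J. Harris, GTM 129 (1991), §11.1, §13.1, Ex. 15.20 (Plücker relation).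
* [vanGeemen1994HodgeAV] B. van Geemen, LNM 1594 (1994), §2.4, Thm. 4.2.
* [VoisinHodgeI2002] C. Voisin, *Hodge Theory I* (2002), §7.1, Thm. 11.30.
-/

noncomputable section

open scoped TensorProduct
open scoped Matrix
open CategoryTheory Module

/-! ### §0 Theorem L-Hg: rational tensors killed by `Θ` are killed by `Lie Hg ⊗ ℂ` -/

namespace Literature.AlgebraicGeometry.Motives

universe u

variable {V : Type u} [AddCommGroup V] [Module ℚ V] [Module.Finite ℚ V] [HodgeTensorFacts.{u, u}] {n : ℤ}

namespace HodgeStructure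

open Literature.RepresentationTheory.GeneralLinear Literature.NumberTheory.DiophantineGeometry

variable {M N k : ℕ}

/-- **Theorem L-Hg (invariance of rational tensors under `Lie Hg(H) ⊗ ℂ`; any rank, any weight).** Let `H` be a polarized
`ℚ`-Hodge structure and `q` a rational coefficient tensor (letters: slots `Fin k` × a `ℚ`-basis `eQ` of `V`) killed — slice by
slice, diagonally — by the matrix of a Hodge operator `Θ` (`= 2p - n` on `V^{p,n-p}`).  Then `q` is killed by the matrix of EVERY
`Y ∈ Lie Hg(H) ⊗ ℂ`: the rational Lie algebra `𝔞 ⊆ 𝔰𝔭_{End_Hdg}(V, ψ)` of operators killing `q` (`annLie`) is bracket-closed and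
`Θ ∈ 𝔞_ℂ` by descent (`mem_spanC_annLie`), so `Lie Hg(H) ≤ 𝔞 ∩ Lie Hg(H)` by Deligne's rigidity (`hodgeLie_rigid`: `Lie Hg` is
the smallest rational Lie algebra whose complexification contains `Θ`, Moonen–Zarhin (3.1)), and `𝔞_ℂ` kills `q_ℂ`.
[cite: MoonenZarhin1999LowDim, §3 (3.1) and §2 (2.3)] [cite: Deligne1982HodgeCycles, I §3 (proof of Prop. 3.4)]
[cite: GoodmanWallachGTM255, §4.1.1] -/
theorem wordDerAt_eq_zero_of_mem_hodgeLieC (H : HodgeStructure V n) (ψ : H.Polarization)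
    (eQ : Module.Basis (Fin M) ℚ V) (q : (Fin N → Fin k × Fin M) → ℚ) {Θ : Module.End ℂ (ℂ ⊗[ℚ] V)}
    (hΘ : ∀ p, ∀ x ∈ H.piece p (n - p), Θ x = ((2 * p - n : ℤ) : ℂ) • x)
    (hΘq : ∀ u : Fin N → Fin k, wordDerAt ℂ (fun _ : Fin N =>
      LinearMap.toMatrix (Algebra.TensorProduct.basis ℂ eQ) (Algebra.TensorProduct.basis ℂ eQ) Θ)
      (wordSlice (fun w => algebraMap ℚ ℂ (q w)) u) = 0)
    {Y : Module.End ℂ (ℂ ⊗[ℚ] V)} (hY : Y ∈ H.hodgeLieC) (u : Fin N → Fin k) :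
    wordDerAt ℂ (fun _ : Fin N =>
      LinearMap.toMatrix (Algebra.TensorProduct.basis ℂ eQ) (Algebra.TensorProduct.basis ℂ eQ) Y)
      (wordSlice (fun w => algebraMap ℚ ℂ (q w)) u) = 0 := by
  set 𝔞 : Submodule ℚ (Module.End ℚ V) := annLie ψ.form eQ (fun a : H.endAlg => (a : Module.End ℚ V)) q
    with h𝔞
  have hΘC : Θ ∈ H.hodgeLieC := H.mem_hodgeLieC_of_forall_piece hΘ
  have hΘ𝔞 : Θ ∈ spanC 𝔞 :=
    mem_spanC_annLie ψ.form eQ _ q hΘq (fun a => commute_baseChange_of_mem_hodgeLieC H hΘC a)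
      fun x y => by rw [formBaseChange_skew_of_mem_hodgeLieC ψ hΘC, neg_add_cancel]
  have hbr : ∀ X ∈ 𝔞, ∀ X' ∈ 𝔞, X * X' - X' * X ∈ 𝔞 := fun X hX X' hX' =>
    commutator_mem_annLie ψ.form eQ _ q hX hX'
  have hΘ𝔞' : Θ ∈ spanC (𝔞 ⊓ H.hodgeLie) := by
    rw [spanC_inf_eq]
    exact ⟨hΘ𝔞, (hodgeLieC_eq_spanC H) ▸ hΘC⟩
  have hbr' : ∀ X ∈ 𝔞 ⊓ H.hodgeLie, ∀ X' ∈ 𝔞 ⊓ H.hodgeLie, X * X' - X' * X ∈ 𝔞 ⊓ H.hodgeLie :=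
    fun X hX X' hX' => ⟨hbr X hX.1 X' hX'.1, H.commutator_mem_hodgeLie hX.2 hX'.2⟩
  have h𝔥le : H.hodgeLie ≤ 𝔞 ⊓ H.hodgeLie :=
    hodgeLie_rigid H ⟨ψ⟩ (𝔞 ⊓ H.hodgeLie) inf_le_right hbr' ⟨Θ, hΘ𝔞', hΘ⟩
  have hY𝔞 : Y ∈ spanC 𝔞 := by
    rw [hodgeLieC_eq_spanC] at hY
    exact spanC_mono (h𝔥le.trans inf_le_left) hY
  rw [h𝔞] at hY𝔞
  exact wordDerAt_eq_zero_of_mem_spanC_annLie ψ.form eQ _ q hY𝔞 u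

end HodgeStructure

end Literature.AlgebraicGeometry.Motives

/-! ### §1 The invariants of `SL₂³` on `(2 ⊠ 2 ⊠ 2)^{⊗4}`: colourwise killed coefficient functions -/

namespace Literature.AlgebraicGeometry.HodgeTheory

namespace SL2Cube

variable {K : Type*} [Field K] [CharZero K]

/-- **One colour: the `𝔰𝔩₂`-invariants of `(K²)^{⊗4}` in coordinates.**  A function `t` on binary words of length `4` which has
`H`-weight zero (`(∑_p ±1) · t(v) = 0`, sign `+` for the letter `0`) and is killed by the raising derivation
(`∑_{p : v_p = 0} t(v[p ↦ 1]) = 0`) is the combination `t(0101) · ε(v₀,v₁)ε(v₂,v₃) + t(0011) · ε(v₀,v₂)ε(v₁,v₃)` of the two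
pairings (`ε(0,1) = 1 = -ε(1,0)`, `ε(a,a) = 0`): the six balanced values satisfy the four raising equations, whose solution
space is the plane of the two pairings (Goodman–Wallach §5.5: `dim (⊗⁴ K²)^{SL₂} = 2`; the third pairing is their difference,
Plücker).  [cite: GoodmanWallachGTM255, §4.1.1 and Thm. 5.3.5 (N = 2, k = 2)] [cite: FultonHarris1991, §11.1 and Ex. 15.20] -/
theorem oneColour (ε : Fin 2 → Fin 2 → K) (hε : ∀ a b, ε a b = if a = b then 0 else if a = 0 then 1 else -1)
    (t : (Fin 4 → Fin 2) → K)
    (hH : ∀ v : Fin 4 → Fin 2, (∑ p, (if v p = 0 then (1 : K) else -1)) * t v = 0)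
    (hE : ∀ v : Fin 4 → Fin 2, (∑ p, if v p = 0 then t (Function.update v p 1) else 0) = 0)
    (v : Fin 4 → Fin 2) :
    t v = t ![0, 1, 0, 1] * (ε (v 0) (v 1) * ε (v 2) (v 3)) + t ![0, 0, 1, 1] * (ε (v 0) (v 2) * ε (v 1) (v 3)) := by
  have h10 : (1 : Fin 2) ≠ 0 := by decide
  have h01 : (0 : Fin 2) ≠ 1 := by decide
  have hcase : ∀ a : Fin 2, a = 0 ∨ a = 1 := by decide
  have hv0 : ∀ a b c d : Fin 2, (![a, b, c, d] : Fin 4 → Fin 2) 0 = a := fun _ _ _ _ => rfl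
  have hv1 : ∀ a b c d : Fin 2, (![a, b, c, d] : Fin 4 → Fin 2) 1 = b := fun _ _ _ _ => rfl
  have hv2 : ∀ a b c d : Fin 2, (![a, b, c, d] : Fin 4 → Fin 2) 2 = c := fun _ _ _ _ => rfl
  have hv3 : ∀ a b c d : Fin 2, (![a, b, c, d] : Fin 4 → Fin 2) 3 = d := fun _ _ _ _ => rfl
  have hu0 : ∀ a b c d x : Fin 2, Function.update (![a, b, c, d] : Fin 4 → Fin 2) 0 x = ![x, b, c, d] := by
    intro a b c d x; funext i; fin_cases i <;> rfl
  have hu1 : ∀ a b c d x : Fin 2, Function.update (![a, b, c, d] : Fin 4 → Fin 2) 1 x = ![a, x, c, d] := by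
    intro a b c d x; funext i; fin_cases i <;> rfl
  have hu2 : ∀ a b c d x : Fin 2, Function.update (![a, b, c, d] : Fin 4 → Fin 2) 2 x = ![a, b, x, d] := by
    intro a b c d x; funext i; fin_cases i <;> rfl
  have hu3 : ∀ a b c d x : Fin 2, Function.update (![a, b, c, d] : Fin 4 → Fin 2) 3 x = ![a, b, c, x] := by
    intro a b c d x; funext i; fin_cases i <;> rfl
  -- the two hypotheses at explicit words
  have hH4 : ∀ a b c d : Fin 2, ((if a = 0 then (1 : K) else -1) + (if b = 0 then (1 : K) else -1) +
      (if c = 0 then (1 : K) else -1) + (if d = 0 then (1 : K) else -1)) * t ![a, b, c, d] = 0 := by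
    intro a b c d
    have h := hH ![a, b, c, d]
    simp only [Fin.sum_univ_four, hv0, hv1, hv2, hv3] at h
    exact h
  have hE4 : ∀ a b c d : Fin 2, (if a = 0 then t ![1, b, c, d] else 0) + (if b = 0 then t ![a, 1, c, d] else 0) +
      (if c = 0 then t ![a, b, 1, d] else 0) + (if d = 0 then t ![a, b, c, 1] else 0) = 0 := by
    intro a b c d
    have h := hE ![a, b, c, d]
    simp only [Fin.sum_univ_four, hv0, hv1, hv2, hv3, hu0, hu1, hu2, hu3] at h
    exact h
  have hz : ∀ a b c d : Fin 2, ((if a = 0 then (1 : K) else -1) + (if b = 0 then (1 : K) else -1) +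
      (if c = 0 then (1 : K) else -1) + (if d = 0 then (1 : K) else -1)) ≠ 0 → t ![a, b, c, d] = 0 :=
    fun a b c d hne => (mul_eq_zero.1 (hH4 a b c d)).resolve_left hne
  -- the four raising equations and the unbalanced zeros
  have e0001 := hE4 0 0 0 1
  have e0010 := hE4 0 0 1 0
  have e0100 := hE4 0 1 0 0
  have e1000 := hE4 1 0 0 0
  simp only [if_true, h10, if_false, add_zero, zero_add] at e0001 e0010 e0100 e1000
  have z0000 := hz 0 0 0 0 (by simp only [if_true]; norm_num)
  have z0001 := hz 0 0 0 1 (by simp only [if_true, h10, if_false]; norm_num)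
  have z0010 := hz 0 0 1 0 (by simp only [if_true, h10, if_false]; norm_num)
  have z0100 := hz 0 1 0 0 (by simp only [if_true, h10, if_false]; norm_num)
  have z1000 := hz 1 0 0 0 (by simp only [if_true, h10, if_false]; norm_num)
  have z0111 := hz 0 1 1 1 (by simp only [if_true, h10, if_false]; norm_num)
  have z1011 := hz 1 0 1 1 (by simp only [if_true, h10, if_false]; norm_num)
  have z1101 := hz 1 1 0 1 (by simp only [if_true, h10, if_false]; norm_num)
  have z1110 := hz 1 1 1 0 (by simp only [if_true, h10, if_false]; norm_num)
  have z1111 := hz 1 1 1 1 (by simp only [h10, if_false]; norm_num)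
  -- the six balanced values in terms of `A = t(0011)`, `B = t(0101)`
  have hC : t ![0, 1, 1, 0] = -t ![0, 0, 1, 1] - t ![0, 1, 0, 1] := by
    linear_combination (e0010 + e0100 - e1000 + e0001) / 2
  have hD : t ![1, 0, 0, 1] = -t ![0, 0, 1, 1] - t ![0, 1, 0, 1] := by linear_combination e0001
  have hEv : t ![1, 0, 1, 0] = t ![0, 1, 0, 1] := by
    linear_combination e0010 - (e0010 + e0100 - e1000 + e0001) / 2
  have hF : t ![1, 1, 0, 0] = t ![0, 0, 1, 1] := by
    linear_combination e0100 - (e0010 + e0100 - e1000 + e0001) / 2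
  -- the sixteen words
  obtain ⟨a, b, c, d, rfl⟩ : ∃ a b c d : Fin 2, v = ![a, b, c, d] :=
    ⟨v 0, v 1, v 2, v 3, by funext i; fin_cases i <;> rfl⟩
  simp only [hv0, hv1, hv2, hv3]
  rcases hcase a with rfl | rfl <;> rcases hcase b with rfl | rfl <;> rcases hcase c with rfl | rfl <;>
    rcases hcase d with rfl | rfl <;>
    simp only [hε, if_true, h10, h01, if_false, mul_one, mul_zero, mul_neg, neg_neg, add_zero,
      zero_add, z0000, z0001, z0010, z0100, z1000, z0111, z1011, z1101, z1110, z1111, hC, hD, hEv, hF] <;>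
    ring

/-- **Three colours: the `2³`-term expansion.**  A function `s` on words of length `4` in the letters of the cube
`Fin 3 → Fin 2` (the weights of `2 ⊠ 2 ⊠ 2`) which, in EACH colour `i`, has `H_i`-weight zero and is killed by the raising
derivation of colour `i`, is the combination of the eight products of pairings `m_j(w⁰) m_k(w¹) m_l(w²)` (`wⁱ` the `i`-th
coordinate word; `m_A = ε₀₁ε₂₃`, `m_B = ε₀₂ε₁₃`) with coefficients its values at the eight words whose coordinate words are
`0101` or `0011` — `oneColour` in each colour, the other colours being parameters (the invariants of `SL₂³` on
`(2 ⊠ 2 ⊠ 2)^{⊗4} = ⊗_i (2_i)^{⊗4}` are the tensor products of the colourwise invariants).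
[cite: GoodmanWallachGTM255, §4.1.1 and Thm. 5.3.5] [cite: MoonenZarhin1999LowDim, §2 (2.5)(1)] -/
theorem threeColour (ε : Fin 2 → Fin 2 → K) (hε : ∀ a b, ε a b = if a = b then 0 else if a = 0 then 1 else -1)
    (mA mB : (Fin 4 → Fin 2) → K) (hmA : ∀ u, mA u = ε (u 0) (u 1) * ε (u 2) (u 3))
    (hmB : ∀ u, mB u = ε (u 0) (u 2) * ε (u 1) (u 3))
    (W : (Fin 4 → Fin 2) → (Fin 4 → Fin 2) → (Fin 4 → Fin 2) → (Fin 4 → Fin 3 → Fin 2))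
    (hW : ∀ x y z p, W x y z p = ![x p, y p, z p])
    (s : (Fin 4 → Fin 3 → Fin 2) → K)
    (hH : ∀ (i : Fin 3) (w : Fin 4 → Fin 3 → Fin 2), (∑ p, (if w p i = 0 then (1 : K) else -1)) * s w = 0)
    (hE : ∀ (i : Fin 3) (w : Fin 4 → Fin 3 → Fin 2),
      (∑ p, if w p i = 0 then s (Function.update w p (Function.update (w p) i 1)) else 0) = 0)
    (w : Fin 4 → Fin 3 → Fin 2) :
    s w =
      s (W ![0, 1, 0, 1] ![0, 1, 0, 1] ![0, 1, 0, 1]) * (mA (fun p => w p 0) * mA (fun p => w p 1) * mA (fun p => w p 2)) +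
      s (W ![0, 1, 0, 1] ![0, 1, 0, 1] ![0, 0, 1, 1]) * (mA (fun p => w p 0) * mA (fun p => w p 1) * mB (fun p => w p 2)) +
      s (W ![0, 1, 0, 1] ![0, 0, 1, 1] ![0, 1, 0, 1]) * (mA (fun p => w p 0) * mB (fun p => w p 1) * mA (fun p => w p 2)) +
      s (W ![0, 1, 0, 1] ![0, 0, 1, 1] ![0, 0, 1, 1]) * (mA (fun p => w p 0) * mB (fun p => w p 1) * mB (fun p => w p 2)) +
      s (W ![0, 0, 1, 1] ![0, 1, 0, 1] ![0, 1, 0, 1]) * (mB (fun p => w p 0) * mA (fun p => w p 1) * mA (fun p => w p 2)) +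
      s (W ![0, 0, 1, 1] ![0, 1, 0, 1] ![0, 0, 1, 1]) * (mB (fun p => w p 0) * mA (fun p => w p 1) * mB (fun p => w p 2)) +
      s (W ![0, 0, 1, 1] ![0, 0, 1, 1] ![0, 1, 0, 1]) * (mB (fun p => w p 0) * mB (fun p => w p 1) * mA (fun p => w p 2)) +
      s (W ![0, 0, 1, 1] ![0, 0, 1, 1] ![0, 0, 1, 1]) * (mB (fun p => w p 0) * mB (fun p => w p 1) * mB (fun p => w p 2)) := by
  classical
  have h3 : ∀ i : Fin 3, i = 0 ∨ i = 1 ∨ i = 2 := by decide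
  -- replacing the coordinate word of colour `i` (an opaque operation with its defining equation)
  obtain ⟨setC, hsetC_apply⟩ : ∃ setC : (Fin 4 → Fin 3 → Fin 2) → Fin 3 → (Fin 4 → Fin 2) → (Fin 4 → Fin 3 → Fin 2),
      ∀ w i v p, setC w i v p = Function.update (w p) i (v p) := ⟨_, fun _ _ _ _ => rfl⟩
  have hsetC_self : ∀ w i, setC w i (fun p => w p i) = w := fun w i => by
    funext p; rw [hsetC_apply, Function.update_eq_self]
  have hsetC_coord : ∀ w i v p, setC w i v p i = v p := fun w i v p => by
    rw [hsetC_apply, Function.update_self]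
  have hsetC_coord_ne : ∀ w i j v p, j ≠ i → setC w i v p j = w p j := fun w i j v p hji => by
    rw [hsetC_apply, Function.update_of_ne hji]
  have hsetC_update : ∀ w i v p, Function.update (setC w i v) p (Function.update (setC w i v p) i 1) =
      setC w i (Function.update v p 1) := by
    intro w i v p
    funext q
    by_cases hq : q = p
    · subst hq
      rw [Function.update_self, hsetC_apply, hsetC_apply, Function.update_idem, Function.update_self]
    · rw [Function.update_of_ne hq, hsetC_apply, hsetC_apply, Function.update_of_ne hq]
  -- `oneColour` in colour `i`, the other colours fixed
  have hone : ∀ w i v, s (setC w i v) =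
      s (setC w i ![0, 1, 0, 1]) * (ε (v 0) (v 1) * ε (v 2) (v 3)) +
      s (setC w i ![0, 0, 1, 1]) * (ε (v 0) (v 2) * ε (v 1) (v 3)) := by
    intro w i
    refine oneColour ε hε (fun v => s (setC w i v)) (fun v => ?_) (fun v => ?_)
    · have h := hH i (setC w i v)
      simp only [hsetC_coord] at h
      exact h
    · have h := hE i (setC w i v)
      simp only [hsetC_coord, hsetC_update] at h
      exact h
  have hone' : ∀ w i, s w = s (setC w i ![0, 1, 0, 1]) * mA (fun p => w p i) + s (setC w i ![0, 0, 1, 1]) * mB (fun p => w p i) := by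
    intro w i
    have h := hone w i (fun p => w p i)
    rw [hsetC_self] at h
    rw [h, hmA, hmB]
  -- the three nested expansions
  have hW3 : ∀ x y z, setC (setC (setC w 0 x) 1 y) 2 z = W x y z := by
    intro x y z
    funext p
    funext i
    rw [hW]
    rcases h3 i with rfl | rfl | rfl
    · rw [hsetC_coord_ne _ _ _ _ _ (by decide), hsetC_coord_ne _ _ _ _ _ (by decide), hsetC_coord]; rfl
    · rw [hsetC_coord_ne _ _ _ _ _ (by decide), hsetC_coord]; rfl
    · rw [hsetC_coord]; rfl
  have hc1 : ∀ x p, setC w 0 x p 1 = w p 1 := fun x p => hsetC_coord_ne _ _ _ _ _ (by decide)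
  have hc2 : ∀ x y p, setC (setC w 0 x) 1 y p 2 = w p 2 := fun x y p => by
    rw [hsetC_coord_ne _ _ _ _ _ (by decide), hsetC_coord_ne _ _ _ _ _ (by decide)]
  rw [hone' w 0]
  rw [hone' (setC w 0 ![0, 1, 0, 1]) 1, hone' (setC w 0 ![0, 0, 1, 1]) 1]
  simp only [hc1]
  rw [hone' (setC (setC w 0 ![0, 1, 0, 1]) 1 ![0, 1, 0, 1]) 2, hone' (setC (setC w 0 ![0, 1, 0, 1]) 1 ![0, 0, 1, 1]) 2,
    hone' (setC (setC w 0 ![0, 0, 1, 1]) 1 ![0, 1, 0, 1]) 2, hone' (setC (setC w 0 ![0, 0, 1, 1]) 1 ![0, 0, 1, 1]) 2]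
  simp only [hc2, hW3]
  ring

omit [CharZero K] in
/-- The pairing sign is antisymmetric: `ε(b,a) = -ε(a,b)`. [cite: FultonHarris1991, §11.1] -/
theorem pairSign_swap (ε : Fin 2 → Fin 2 → K) (hε : ∀ a b, ε a b = if a = b then 0 else if a = 0 then 1 else -1)
    (a b : Fin 2) : ε b a = -ε a b := by
  have h10 : (1 : Fin 2) ≠ 0 := by decide
  have h01 : (0 : Fin 2) ≠ 1 := by decide
  have hcase : ∀ a : Fin 2, a = 0 ∨ a = 1 := by decide
  rcases hcase a with rfl | rfl <;> rcases hcase b with rfl | rfl <;> simp only [hε, if_true, h10, h01, if_false, neg_zero, neg_neg]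

omit [CharZero K] in
/-- **The Plücker relation** `ε(u₀,u₂)ε(u₁,u₃) = ε(u₀,u₁)ε(u₂,u₃) + ε(u₀,u₃)ε(u₁,u₂)` between the three pairings of four
letters of `K²` (the unique linear relation among the `SL₂`-invariants of `(K²)^{⊗4}`).
[cite: FultonHarris1991, Ex. 15.20 and §11.1] [cite: GoodmanWallachGTM255, Thm. 5.3.5] -/
theorem pluecker (ε : Fin 2 → Fin 2 → K) (hε : ∀ a b, ε a b = if a = b then 0 else if a = 0 then 1 else -1)
    (u : Fin 4 → Fin 2) :
    ε (u 0) (u 2) * ε (u 1) (u 3) = ε (u 0) (u 1) * ε (u 2) (u 3) + ε (u 0) (u 3) * ε (u 1) (u 2) := by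
  have h10 : (1 : Fin 2) ≠ 0 := by decide
  have h01 : (0 : Fin 2) ≠ 1 := by decide
  have hcase : ∀ a : Fin 2, a = 0 ∨ a = 1 := by decide
  rcases hcase (u 0) with h0 | h0 <;> rcases hcase (u 1) with h1 | h1 <;> rcases hcase (u 2) with h2 | h2 <;>
    rcases hcase (u 3) with h3 | h3 <;>
    simp only [h0, h1, h2, h3, hε, if_true, h10, h01, if_false, mul_one, mul_zero, mul_neg, neg_neg,
      add_zero, zero_add, neg_zero, add_neg_cancel]

omit [CharZero K] in
/-- The three pairings `m_A = ε₀₁ε₂₃`, `m_B = ε₀₂ε₁₃`, `m_C = ε₀₃ε₁₂` under the transposition `(0 1)` of the positions: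
`m_A ↦ -m_A`, `m_B ↦ m_C`, `m_C ↦ m_B`. [cite: GoodmanWallachGTM255, Thm. 5.3.5] [cite: FultonHarris1991, §11.1] -/
theorem pairings_swap01 (ε : Fin 2 → Fin 2 → K) (hε : ∀ a b, ε a b = if a = b then 0 else if a = 0 then 1 else -1)
    (mA mB mC : (Fin 4 → Fin 2) → K) (hmA : ∀ u, mA u = ε (u 0) (u 1) * ε (u 2) (u 3))
    (hmB : ∀ u, mB u = ε (u 0) (u 2) * ε (u 1) (u 3)) (hmC : ∀ u, mC u = ε (u 0) (u 3) * ε (u 1) (u 2))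
    (u : Fin 4 → Fin 2) :
    mA (u ∘ Equiv.swap (0 : Fin 4) 1) = -mA u ∧ mB (u ∘ Equiv.swap (0 : Fin 4) 1) = mC u ∧
      mC (u ∘ Equiv.swap (0 : Fin 4) 1) = mB u := by
  have hs0 : Equiv.swap (0 : Fin 4) 1 0 = 1 := Equiv.swap_apply_left _ _
  have hs1 : Equiv.swap (0 : Fin 4) 1 1 = 0 := Equiv.swap_apply_right _ _
  have hs2 : Equiv.swap (0 : Fin 4) 1 2 = 2 := Equiv.swap_apply_of_ne_of_ne (by decide) (by decide)
  have hs3 : Equiv.swap (0 : Fin 4) 1 3 = 3 := Equiv.swap_apply_of_ne_of_ne (by decide) (by decide)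
  refine ⟨?_, ?_, ?_⟩
  · rw [hmA, hmA, Function.comp_apply, Function.comp_apply, Function.comp_apply, Function.comp_apply, hs0, hs1, hs2,
      hs3, pairSign_swap ε hε (u 0) (u 1), neg_mul]
  · rw [hmB, hmC, Function.comp_apply, Function.comp_apply, Function.comp_apply, Function.comp_apply, hs0, hs1, hs2,
      hs3, mul_comm]
  · rw [hmC, hmB, Function.comp_apply, Function.comp_apply, Function.comp_apply, Function.comp_apply, hs0, hs1, hs2,
      hs3, mul_comm]

omit [CharZero K] in
/-- The three pairings under the transposition `(1 2)` of the positions: `m_A ↦ m_B`, `m_B ↦ m_A`, `m_C ↦ -m_C`.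
[cite: GoodmanWallachGTM255, Thm. 5.3.5] [cite: FultonHarris1991, §11.1] -/
theorem pairings_swap12 (ε : Fin 2 → Fin 2 → K) (hε : ∀ a b, ε a b = if a = b then 0 else if a = 0 then 1 else -1)
    (mA mB mC : (Fin 4 → Fin 2) → K) (hmA : ∀ u, mA u = ε (u 0) (u 1) * ε (u 2) (u 3))
    (hmB : ∀ u, mB u = ε (u 0) (u 2) * ε (u 1) (u 3)) (hmC : ∀ u, mC u = ε (u 0) (u 3) * ε (u 1) (u 2))
    (u : Fin 4 → Fin 2) :
    mA (u ∘ Equiv.swap (1 : Fin 4) 2) = mB u ∧ mB (u ∘ Equiv.swap (1 : Fin 4) 2) = mA u ∧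
      mC (u ∘ Equiv.swap (1 : Fin 4) 2) = -mC u := by
  have hs0 : Equiv.swap (1 : Fin 4) 2 0 = 0 := Equiv.swap_apply_of_ne_of_ne (by decide) (by decide)
  have hs1 : Equiv.swap (1 : Fin 4) 2 1 = 2 := Equiv.swap_apply_left _ _
  have hs2 : Equiv.swap (1 : Fin 4) 2 2 = 1 := Equiv.swap_apply_right _ _
  have hs3 : Equiv.swap (1 : Fin 4) 2 3 = 3 := Equiv.swap_apply_of_ne_of_ne (by decide) (by decide)
  refine ⟨?_, ?_, ?_⟩
  · rw [hmA, hmB, Function.comp_apply, Function.comp_apply, Function.comp_apply, Function.comp_apply, hs0, hs1, hs2, hs3]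
  · rw [hmB, hmA, Function.comp_apply, Function.comp_apply, Function.comp_apply, Function.comp_apply, hs0, hs1, hs2, hs3]
  · rw [hmC, hmC, Function.comp_apply, Function.comp_apply, Function.comp_apply, Function.comp_apply, hs0, hs1, hs2,
      hs3, pairSign_swap ε hε (u 1) (u 2), mul_neg]

omit [CharZero K] in
/-- The two pairings `m_A`, `m_B` are orthonormal idempotent-like in the letter sum: `∑_a ε(a,b) ε(a,b') = [b = b']`
(`εᵀ ε = 1` for the `2 × 2` symplectic matrix). [cite: FultonHarris1991, §11.1] -/
theorem sum_pairSign_mul_pairSign (ε : Fin 2 → Fin 2 → K)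
    (hε : ∀ a b, ε a b = if a = b then 0 else if a = 0 then 1 else -1) (b b' : Fin 2) :
    ∑ a, ε a b * ε a b' = if b = b' then 1 else 0 := by
  have h10 : (1 : Fin 2) ≠ 0 := by decide
  have h01 : (0 : Fin 2) ≠ 1 := by decide
  have hcase : ∀ a : Fin 2, a = 0 ∨ a = 1 := by decide
  rw [Fin.sum_univ_two]
  rcases hcase b with rfl | rfl <;> rcases hcase b' with rfl | rfl <;>
    simp only [hε, if_true, h10, h01, if_false, mul_one, mul_zero, add_zero, zero_add, mul_neg, neg_neg, neg_zero]

end SL2Cube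

/-- **Evaluation against an alternating map only sees coefficient functions up to the position action**:
`wordEval F y (w ↦ a(w ∘ σ)) = sgn(σ) · wordEval F y a`. [cite: Greub1978Multilinear, §4.2 (4.2) and §5.7 (5.13)] -/
theorem wordEval_precomp_perm {K : Type*} [CommRing K] {H M : Type*} [AddCommGroup H] [Module K H] [AddCommGroup M]
    [Module K M] {I : Type*} [Fintype I] {d : ℕ} (F : H [⋀^Fin d]→ₗ[K] M) (y : I → H) (a : (Fin d → I) → K)
    (σ : Equiv.Perm (Fin d)) :
    Literature.RepresentationTheory.GeneralLinear.wordEval F y (fun w => a (w ∘ ⇑σ)) =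
      ((Equiv.Perm.sign σ : ℤ) : K) • Literature.RepresentationTheory.GeneralLinear.wordEval F y a := by
  open Literature.RepresentationTheory.GeneralLinear in
  rw [wordEval_apply, wordEval_apply, Finset.smul_sum]
  refine Fintype.sum_equiv (wordPermEquiv I σ) _ _ fun w => ?_
  rw [wordPermEquiv_apply, show y ∘ (w ∘ ⇑σ) = (y ∘ w) ∘ ⇑σ from rfl, map_comp_perm_eq_sign_smul, smul_smul, smul_smul,
    mul_right_comm, sign_cast_mul_self, one_mul]

/-! ### §2 `B²(X) ⊆ D²(X) ⊗ ℂ` when `Lie Hg(H¹(X)) ⊗ ℂ` contains three commuting standard `𝔰𝔩₂`-triples -/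

section SL2Cubed

open Literature.AlgebraicTopology.SingularHomology
open Literature.AlgebraicGeometry.Motives (IsSmoothProjective AbelianVariety bettiCohomology
  ofRatClassBaseChange ofRatClassBaseChange_tmul HodgeTensorFacts hodgeTensorFacts_holds)
open Literature.Barriers.HodgeConjecture
open Literature.AlgebraicGeometry.Motives.HodgeStructure
open Literature.RepresentationTheory.GeneralLinear
open Literature.RepresentationTheory.ClassicalInvariants
open Literature.NumberTheory.DiophantineGeometry

variable {X : AbelianVariety ℂ}

set_option maxHeartbeats 4000000 in
open scoped Classical in
/-- **`B²(X) ⊆ D²(X) ⊗ ℂ` for a complex abelian variety whose complexified Hodge Lie algebra contains three pairwise commuting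
standard `𝔰𝔩₂`-triples on `H¹(X; ℚ) ⊗ ℂ ≅ ℂ⁸`, the first `H` being a Hodge operator** (the situation «`Hg(X)` is a `ℚ`-form of an
almost direct product of three copies of `SL₂` … `V_ℂ = 2 ⊠ 2 ⊠ 2`» of Moonen–Zarhin (2.5)(1), in which «the Hodge ring of `X` is
generated by divisor classes»).  Data: `hHD, hI` the tree's real Hodge model hypotheses, `ψ` a polarization of `H¹`, `dim_ℚ H¹ = 8`,
`(H_i, E_i, F_i)_{i<3}` operators of `H¹ ⊗ ℂ` in `Lie Hg ⊗ ℂ` in standard form, pairwise commuting across `i`, `H_0 = Θ`.  Conclusion: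
every rational `(2,2)`-class `c ∈ H⁴(X(ℂ); ℂ)` lies in `divisorClassesSpan X.X X.dim 2`.  PROOF: see the module docstring (§2).
[cite: MoonenZarhin1999LowDim, Thm. (0.1)(3) and §2 (2.5)(1)] [cite: Milne1999LefschetzClasses, Prop. 3.3, Prop. 3.6 (a) and Remark 3.7]
[cite: GoodmanWallachGTM255, §4.1.1 and Thm. 5.3.5] [cite: Deligne1982HodgeCycles, I §3 (proof of Prop. 3.4)] -/
theorem mem_divisorClassesSpan_two_of_sl2Triples [HodgeTensorFacts.{0, 0}]
    (hHD : exists_isReal_hodgeModel) (hI : hodgePQ_independent_of_hodgeModel)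
    (ψ : (BettiUniverse.hodge hHD (AbelianVariety.isSmoothProjective_holds (A := X)) 1).Polarization)
    (hV : Module.finrank ℚ (bettiCohomology X.X 1) = 8)
    (Hh Ee Ff : Fin 3 → Module.End ℂ (ℂ ⊗[ℚ] bettiCohomology X.X 1))
    (hΘ : ∀ p, ∀ x ∈ (BettiUniverse.hodge hHD (AbelianVariety.isSmoothProjective_holds (A := X)) 1).piece p
      (((1 : ℕ) : ℤ) - p), Hh 0 x = ((2 * p - ((1 : ℕ) : ℤ) : ℤ) : ℂ) • x)
    (hmem : ∀ i, Hh i ∈ (BettiUniverse.hodge hHD (AbelianVariety.isSmoothProjective_holds (A := X)) 1).hodgeLieC ∧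
      Ee i ∈ (BettiUniverse.hodge hHD (AbelianVariety.isSmoothProjective_holds (A := X)) 1).hodgeLieC ∧
      Ff i ∈ (BettiUniverse.hodge hHD (AbelianVariety.isSmoothProjective_holds (A := X)) 1).hodgeLieC)
    (hstd : ∀ i, Hh i * Hh i = 1 ∧ Ee i * Ee i = 0 ∧ Ff i * Ff i = 0 ∧ Ee i * Ff i = (2 : ℂ)⁻¹ • (1 + Hh i) ∧
      Ff i * Ee i = (2 : ℂ)⁻¹ • (1 - Hh i) ∧ Hh i * Ee i = Ee i ∧ Ee i * Hh i = -Ee i ∧ Hh i * Ff i = -Ff i ∧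
      Ff i * Hh i = Ff i)
    (hcomm : ∀ i j, i ≠ j →
      Hh i * Hh j = Hh j * Hh i ∧ Hh i * Ee j = Ee j * Hh i ∧ Hh i * Ff j = Ff j * Hh i ∧
      Ee i * Hh j = Hh j * Ee i ∧ Ee i * Ee j = Ee j * Ee i ∧ Ee i * Ff j = Ff j * Ee i ∧
      Ff i * Hh j = Hh j * Ff i ∧ Ff i * Ee j = Ee j * Ff i ∧ Ff i * Ff j = Ff j * Ff i)
    {c : complexBetti X.X (2 * 2)} (hcQ : IsRationalClass c) (hc : IsOfHodgeType X.dim X.X (2 * 2) 2 2 c) :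
    c ∈ divisorClassesSpan X.X X.dim 2 := by
  classical
  -- the setting
  have hX : IsSmoothProjective X.dim X.X := AbelianVariety.isSmoothProjective_holds
  haveI : Module.Finite ℚ (bettiCohomology X.X 1) := finite_bettiCohomology_one X
  have hn1 : (((1 : ℕ) : ℤ)) = 1 := Nat.cast_one
  have heff := BettiUniverse.hodge_isEffective hHD hX 1
  have hp : 0 < 2 := two_pos
  have h10 : (1 : Fin 2) ≠ 0 := by decide
  have h01 : (0 : Fin 2) ≠ 1 := by decide
  have hcase : ∀ a : Fin 2, a = 0 ∨ a = 1 := by decide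
  set F := cupPowOneAlt ℂ (Motives.ComplexPoints X.X) (2 * 2) with hFdef
  have hFinj : Function.Injective (exteriorPower.alternatingMapLinearEquiv F) :=
    injective_alternatingMapLinearEquiv_cupPowOneAlt X (2 * 2)
  set Ψ := ψ.form.baseChange ℂ with hΨ
  obtain ⟨hP10, hP01, -, -, -⟩ :=
    UnitaryTheta.theta_facts (BettiUniverse.hodge hHD (AbelianVariety.isSmoothProjective_holds (A := X)) 1) hn1 heff hΘ
  -- the cube basis of joint weight vectors (`SL2Triple.exists_cubeBasis`)
  have hW8 : Module.finrank ℂ (ℂ ⊗[ℚ] bettiCohomology X.X 1) = 8 := by rw [Module.finrank_baseChange, hV]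
  obtain ⟨cb, hbH, hbE1, hbE0, -, -, hGram⟩ := SL2Triple.exists_cubeBasis Hh Ee Ff hstd hcomm hW8
  have hcb10 : ∀ x : Fin 3 → Fin 2, x 0 = 0 →
      cb x ∈ (BettiUniverse.hodge hHD (AbelianVariety.isSmoothProjective_holds (A := X)) 1).piece 1 0 := by
    intro x hx
    have h := hbH 0 x
    rw [if_pos hx, one_smul] at h
    have h2 := hP10 (cb x)
    rwa [h, ← two_smul ℂ (cb x), smul_smul, inv_mul_cancel₀ (two_ne_zero' ℂ), one_smul] at h2
  have hcb01 : ∀ x : Fin 3 → Fin 2, x 0 = 1 →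
      cb x ∈ (BettiUniverse.hodge hHD (AbelianVariety.isSmoothProjective_holds (A := X)) 1).piece 0 1 := by
    intro x hx
    have h := hbH 0 x
    rw [hx, if_neg h10, neg_one_smul] at h
    have h2 := hP01 (cb x)
    rwa [h, sub_neg_eq_add, ← two_smul ℂ (cb x), smul_smul, inv_mul_cancel₀ (two_ne_zero' ℂ), one_smul] at h2
  -- letters `Fin 8`
  have hcard : Fintype.card (Fin 3 → Fin 2) = 8 := by
    rw [Fintype.card_fun, Fintype.card_fin, Fintype.card_fin]; norm_num
  obtain ⟨e8, -⟩ : ∃ _e : (Fin 3 → Fin 2) ≃ Fin 8, True := ⟨Fintype.equivFinOfCardEq hcard, trivial⟩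
  set cbσ : Module.Basis (Fin 8) ℂ (ℂ ⊗[ℚ] bettiCohomology X.X 1) := cb.reindex e8 with hcbσdef
  have hcbσ : ∀ i, cbσ i = cb (e8.symm i) := fun i => by rw [hcbσdef, Module.Basis.reindex_apply]
  have hcbσ' : ∀ x, cb x = cbσ (e8 x) := fun x => by rw [hcbσ, Equiv.symm_apply_apply]
  set eQ : Module.Basis (Fin 8) ℚ (bettiCohomology X.X 1) := Module.finBasisOfFinrankEq ℚ _ hV with heQ
  set eC : Module.Basis (Fin 8) ℂ (ℂ ⊗[ℚ] bettiCohomology X.X 1) := Algebra.TensorProduct.basis ℂ eQ with heC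
  -- kinds of the letters: `κ' i = 0` ↔ `cbσ i ∈ H^{1,0}`
  obtain ⟨κ', hκ'⟩ : ∃ κ' : Fin 8 → Fin 2, ∀ i, κ' i = e8.symm i 0 := ⟨_, fun _ => rfl⟩
  have hkind0 : ∀ i, κ' i = 0 →
      cbσ i ∈ (BettiUniverse.hodge hHD (AbelianVariety.isSmoothProjective_holds (A := X)) 1).piece 1 0 := by
    intro i hi; rw [hcbσ]; exact hcb10 _ (by rw [← hκ']; exact hi)
  have hkind1 : ∀ i, κ' i = 1 →
      cbσ i ∈ (BettiUniverse.hodge hHD (AbelianVariety.isSmoothProjective_holds (A := X)) 1).piece 0 1 := by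
    intro i hi; rw [hcbσ]; exact hcb01 _ (by rw [← hκ']; exact hi)
  -- letters in `H¹(X(ℂ); ℂ)`
  set ρ := ofRatClassBaseChangeEquiv hX 1 with hρ
  set v : Module.Basis _ ℂ (complexBetti X.X 1) := cbσ.map ρ with hv
  set eL : Module.Basis _ ℂ (complexBetti X.X 1) := eC.map ρ with heL
  have heLQ : ∀ i, IsRationalClass (eL i) := fun i => by
    rw [heL, Module.Basis.map_apply, heC, Algebra.TensorProduct.basis_apply, hρ,
      ofRatClassBaseChangeEquiv_apply, ofRatClassBaseChange_tmul, one_smul]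
    exact isRationalClass_ofRatClass _
  have hv_apply : ∀ i, v i = ofRatClassBaseChange (Motives.ComplexPoints X.X) 1 (cbσ i) := fun i => by
    rw [hv, Module.Basis.map_apply, hρ, ofRatClassBaseChangeEquiv_apply]
  have hv0 : ∀ i, κ' i = 0 → IsOfHodgeType X.dim X.X 1 1 0 (v i) := by
    intro i hi
    rw [hv_apply, ← BettiUniverse.mem_hodge_piece_iff hHD hI hX (k := 1) (p := 1) (q := 0) rfl]
    exact hkind0 i hi
  have hv1 : ∀ i, κ' i = 1 → IsOfHodgeType X.dim X.X 1 0 1 (v i) := by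
    intro i hi
    rw [hv_apply, ← BettiUniverse.mem_hodge_piece_iff hHD hI hX (k := 1) (p := 0) (q := 1) rfl]
    exact hkind1 i hi
  -- (α) an antisymmetric kind-balanced coefficient function in the letters `v = ρ ∘ cbσ` (one slot, `g = 𝟙`)
  have hg := avSlots_self X
  obtain ⟨ax, hax_bal, hax_anti, hcax⟩ := hg.exists_antisymm_kindBalanced_wordEval_eq v κ' hv0 hv1 hp hc
  -- the change of letters to the rational letters
  set G : Matrix _ _ ℂ := eC.toMatrix cbσ with hG
  set G' : Matrix _ _ ℂ := cbσ.toMatrix eC with hG'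
  have hG'G : G' * G = 1 := cbσ.toMatrix_mul_toMatrix_flip eC
  have hve : ∀ i, v i = ∑ i', G i' i • eL i' := fun i => by
    simp only [hv, heL, Module.Basis.map_apply, ← map_smul, ← map_sum]
    congr 1
    exact (eC.sum_toMatrix_smul_self (v := ⇑cbσ) (j := i)).symm
  have hletters : ∀ j i, avLetters ![𝟙 X] v (j, i) = ∑ i', G i' i • avLetters ![𝟙 X] eL (j, i') :=
    avLetters_baseChange ![𝟙 X] G hve
  set aE := colourChangeAt (fun _ : Fin 1 => G) ax with haE
  have haE_anti : IsAntisymm aE := hax_anti.colourChangeAt _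
  have hcaE : wordEval F (avLetters ![𝟙 X] eL) aE = c := by
    rw [haE, ← wordEval_eq_wordEval_colourChangeAt F (fun _ : Fin 1 => G) hletters ax, hcax]
  obtain ⟨q, hq⟩ := hg.exists_rat_wordEval_eq eL heLQ hcQ
  obtain ⟨q', -, haEq⟩ := haE_anti.exists_eq_algebraMap_of_wordEval_eq hFinj (hg.letterBasis eL)
    (q := q) (by rw [AVSlots.coe_letterBasis, hcaE, hFdef, hq])
  have hslice_e : ∀ u, wordSlice aE u = wordRepAt ℂ (fun _ : Fin (2 * 2) => G) (wordSlice ax u) :=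
    fun u => wordSlice_colourChangeAt (fun _ : Fin 1 => G) ax u
  -- `Θ = H_0` is `diag(±1)` in the letters and kills the slices
  have hΘb : ∀ i, Hh 0 (cbσ i) = (if κ' i = 0 then (1 : ℂ) else -1) • cbσ i := fun i => by
    rw [hcbσ, hbH 0, hκ']
  have hΘcb : LinearMap.toMatrix cbσ cbσ (Hh 0) = kindDiag κ' := by
    ext i i'
    rw [LinearMap.toMatrix_apply, hΘb, map_smul, Module.Basis.repr_self, Finsupp.smul_apply,
      Finsupp.single_apply, kindDiag, Matrix.diagonal_apply, smul_eq_mul, mul_ite, mul_one, mul_zero]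
    by_cases hii : i = i'
    · subst hii; rw [if_pos rfl]
    · rw [if_neg (Ne.symm hii), if_neg hii]
  have hJG : LinearMap.toMatrix eC eC (Hh 0) * G = G * kindDiag κ' := by
    rw [← hΘcb, hG, linearMap_toMatrix_mul_basis_toMatrix, basis_toMatrix_mul_linearMap_toMatrix]
  have hΘq : ∀ u : Fin (2 * 2) → Fin 1, wordDerAt ℂ (fun _ : Fin (2 * 2) => LinearMap.toMatrix eC eC (Hh 0))
      (wordSlice (fun w => algebraMap ℚ ℂ (q' w)) u) = 0 := by
    intro u
    rw [← haEq, hslice_e]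
    refine wordDerAt_wordRepAt_eq_zero_of_mul_eq ℂ (fun _ : Fin (2 * 2) => G) (fun _ => hJG) ?_
    rw [wordDerAt_const]
    exact wordDer_kindDiag_wordSlice_eq_zero κ' hax_bal u
  -- (β) THEOREM L-Hg: every `Y ∈ Lie Hg ⊗ ℂ` kills the slices (in the letters `cbσ`)
  have key : ∀ Y ∈ (BettiUniverse.hodge hHD (AbelianVariety.isSmoothProjective_holds (A := X)) 1).hodgeLieC,
      ∀ u : Fin (2 * 2) → Fin 1,
        wordDerAt ℂ (fun _ : Fin (2 * 2) => LinearMap.toMatrix cbσ cbσ Y) (wordSlice ax u) = 0 := by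
    intro Y hY u
    have hL := wordDerAt_eq_zero_of_mem_hodgeLieC
      (BettiUniverse.hodge hHD (AbelianVariety.isSmoothProjective_holds (A := X)) 1) ψ eQ q' hΘ hΘq hY u
    rw [← haEq, hslice_e] at hL
    have hYG : ∀ _t : Fin (2 * 2), LinearMap.toMatrix eC eC Y * G = G * LinearMap.toMatrix cbσ cbσ Y :=
      fun _ => by rw [hG, linearMap_toMatrix_mul_basis_toMatrix, basis_toMatrix_mul_linearMap_toMatrix]
    have h3 : wordRepAt ℂ (fun _ : Fin (2 * 2) => G)
        (wordDerAt ℂ (fun _ : Fin (2 * 2) => LinearMap.toMatrix cbσ cbσ Y) (wordSlice ax u)) = 0 := by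
      rw [wordRepAt_wordDerAt_of_mul_eq ℂ (fun _ : Fin (2 * 2) => G) hYG, hL]
    exact wordRepAt_injective ℂ (g := fun _ : Fin (2 * 2) => G) (g' := fun _ : Fin (2 * 2) => G')
      (funext fun _ => hG'G) (by rw [h3, map_zero])
  -- (γ) the matrices of `H_i`, `E_i` in the letters and the resulting equations on the slice `sl`
  obtain ⟨u0, hu0⟩ : ∃ u0 : Fin (2 * 2) → Fin 1, ∀ p, u0 p = 0 := ⟨fun _ => 0, fun _ => rfl⟩
  obtain ⟨sl, hsl⟩ : ∃ sl : (Fin (2 * 2) → Fin 8) → ℂ, ∀ ε, sl ε = wordSlice ax u0 ε := ⟨_, fun _ => rfl⟩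
  have hslfun : wordSlice ax u0 = sl := funext fun ε => (hsl ε).symm
  have hMH : ∀ i r b, LinearMap.toMatrix cbσ cbσ (Hh i) r b =
      if b = r then (if e8.symm b i = 0 then (1 : ℂ) else -1) else 0 := by
    intro i r b
    rw [LinearMap.toMatrix_apply, hcbσ b, hbH i, ← hcbσ b, map_smul, Module.Basis.repr_self, Finsupp.smul_apply,
      Finsupp.single_apply, smul_eq_mul, mul_ite, mul_one, mul_zero]
  have hME : ∀ i r b, LinearMap.toMatrix cbσ cbσ (Ee i) r b =
      if e8.symm b i = 1 then (if e8 (Function.update (e8.symm b) i 0) = r then (1 : ℂ) else 0) else 0 := by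
    intro i r b
    rw [LinearMap.toMatrix_apply, hcbσ b]
    rcases hcase (e8.symm b i) with h | h
    · rw [hbE0 i _ h, map_zero, Finsupp.zero_apply, h, if_neg h01]
    · rw [hbE1 i _ h, hcbσ', Module.Basis.repr_self, Finsupp.single_apply, h, if_pos rfl]
  have hHeq : ∀ (i : Fin 3) (w : Fin (2 * 2) → Fin 8),
      (∑ p, (if e8.symm (w p) i = 0 then (1 : ℂ) else -1)) * sl w = 0 := by
    intro i w
    have h := congr_fun (key (Hh i) (hmem i).1 u0) w
    rw [hslfun, wordDerAt_apply, Pi.zero_apply] at h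
    rw [Finset.sum_mul]
    refine Eq.trans ?_ h
    refine Finset.sum_congr rfl fun p _ => ?_
    rw [Finset.sum_eq_single (w p) (fun b _ hb => by rw [hMH, if_neg hb, zero_mul])
      (fun h => absurd (Finset.mem_univ _) h), hMH, if_pos rfl, Function.update_eq_self]
  have hEeq : ∀ (i : Fin 3) (w : Fin (2 * 2) → Fin 8),
      (∑ p, if e8.symm (w p) i = 0 then sl (Function.update w p (e8 (Function.update (e8.symm (w p)) i 1)))
        else 0) = 0 := by
    intro i w
    have h := congr_fun (key (Ee i) (hmem i).2.1 u0) w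
    rw [hslfun, wordDerAt_apply, Pi.zero_apply] at h
    refine Eq.trans ?_ h
    refine Finset.sum_congr rfl fun p _ => ?_
    rcases hcase (e8.symm (w p) i) with h0 | h1
    · rw [if_pos h0]
      obtain ⟨b₀, hb₀⟩ : ∃ b₀ : Fin 8, b₀ = e8 (Function.update (e8.symm (w p)) i 1) := ⟨_, rfl⟩
      rw [← hb₀, Finset.sum_eq_single b₀ ?_ (fun h => absurd (Finset.mem_univ _) h)]
      · rw [hME, hb₀, Equiv.symm_apply_apply, Function.update_self, if_pos rfl, Function.update_idem,
          ← h0, Function.update_eq_self, Equiv.apply_symm_apply, if_pos rfl, one_mul]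
      · intro b _ hb
        rw [hME]
        by_cases hbi : e8.symm b i = 1
        · rw [if_pos hbi]
          by_cases hbr : e8 (Function.update (e8.symm b) i 0) = w p
          · exfalso
            apply hb
            rw [hb₀, ← hbr, Equiv.symm_apply_apply, Function.update_idem, ← hbi, Function.update_eq_self,
              Equiv.apply_symm_apply]
          · rw [if_neg hbr, zero_mul]
        · rw [if_neg hbi, zero_mul]
    · rw [if_neg (by rw [h1]; exact h10)]
      refine (Finset.sum_eq_zero fun b _ => ?_).symm
      rw [hME]
      by_cases hbi : e8.symm b i = 1
      · rw [if_pos hbi]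
        by_cases hbr : e8 (Function.update (e8.symm b) i 0) = w p
        · exfalso
          have h' := congr_fun (congrArg e8.symm hbr) i
          rw [Equiv.symm_apply_apply, Function.update_self] at h'
          rw [← h'] at h1
          exact h01 h1
        · rw [if_neg hbr, zero_mul]
      · rw [if_neg hbi, zero_mul]
  -- (δ) the cube words: `SL2Cube.threeColour`
  obtain ⟨εf, hεf⟩ : ∃ εf : Fin 2 → Fin 2 → ℂ, ∀ a b, εf a b = if a = b then 0 else if a = 0 then 1 else -1 :=
    ⟨_, fun _ _ => rfl⟩
  obtain ⟨mA, hmA⟩ : ∃ mA : (Fin 4 → Fin 2) → ℂ, ∀ u, mA u = εf (u 0) (u 1) * εf (u 2) (u 3) := ⟨_, fun _ => rfl⟩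
  obtain ⟨mB, hmB⟩ : ∃ mB : (Fin 4 → Fin 2) → ℂ, ∀ u, mB u = εf (u 0) (u 2) * εf (u 1) (u 3) := ⟨_, fun _ => rfl⟩
  obtain ⟨mC, hmC⟩ : ∃ mC : (Fin 4 → Fin 2) → ℂ, ∀ u, mC u = εf (u 0) (u 3) * εf (u 1) (u 2) := ⟨_, fun _ => rfl⟩
  obtain ⟨W, hW⟩ : ∃ W : (Fin 4 → Fin 2) → (Fin 4 → Fin 2) → (Fin 4 → Fin 2) → (Fin 4 → Fin 3 → Fin 2),
      ∀ x y z p, W x y z p = ![x p, y p, z p] := ⟨_, fun _ _ _ _ => rfl⟩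
  obtain ⟨s', hs'⟩ : ∃ s' : (Fin (2 * 2) → Fin 3 → Fin 2) → ℂ, ∀ w', s' w' = sl (⇑e8 ∘ w') := ⟨_, fun _ => rfl⟩
  have hH' : ∀ (i : Fin 3) (w' : Fin 4 → Fin 3 → Fin 2),
      (∑ p, (if w' p i = 0 then (1 : ℂ) else -1)) * s' w' = 0 := by
    intro i w'
    have h := hHeq i (⇑e8 ∘ w')
    simp only [Function.comp_apply, Equiv.symm_apply_apply] at h
    rw [hs']
    exact h
  have hE' : ∀ (i : Fin 3) (w' : Fin 4 → Fin 3 → Fin 2),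
      (∑ p, if w' p i = 0 then s' (Function.update w' p (Function.update (w' p) i 1)) else 0) = 0 := by
    intro i w'
    have h := hEeq i (⇑e8 ∘ w')
    simp only [Function.comp_apply, Equiv.symm_apply_apply] at h
    simp only [hs', Function.comp_update]
    exact h
  have hexp := SL2Cube.threeColour εf hεf mA mB hmA hmB W hW s' hH' hE'
  -- the products of pairings as coefficient functions on words in the letters `Fin 8`
  obtain ⟨Qf, hQf⟩ : ∃ Qf : ((Fin 4 → Fin 2) → ℂ) → ((Fin 4 → Fin 2) → ℂ) → ((Fin 4 → Fin 2) → ℂ) →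
      (Fin (2 * 2) → Fin 8) → ℂ, ∀ m m' m'' ε, Qf m m' m'' ε =
        m (fun p => e8.symm (ε p) 0) * m' (fun p => e8.symm (ε p) 1) * m'' (fun p => e8.symm (ε p) 2) :=
    ⟨_, fun _ _ _ _ => rfl⟩
  have hsl_exp : sl =
      s' (W ![0, 1, 0, 1] ![0, 1, 0, 1] ![0, 1, 0, 1]) • Qf mA mA mA +
      s' (W ![0, 1, 0, 1] ![0, 1, 0, 1] ![0, 0, 1, 1]) • Qf mA mA mB +
      s' (W ![0, 1, 0, 1] ![0, 0, 1, 1] ![0, 1, 0, 1]) • Qf mA mB mA +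
      s' (W ![0, 1, 0, 1] ![0, 0, 1, 1] ![0, 0, 1, 1]) • Qf mA mB mB +
      s' (W ![0, 0, 1, 1] ![0, 1, 0, 1] ![0, 1, 0, 1]) • Qf mB mA mA +
      s' (W ![0, 0, 1, 1] ![0, 1, 0, 1] ![0, 0, 1, 1]) • Qf mB mA mB +
      s' (W ![0, 0, 1, 1] ![0, 0, 1, 1] ![0, 1, 0, 1]) • Qf mB mB mA +
      s' (W ![0, 0, 1, 1] ![0, 0, 1, 1] ![0, 0, 1, 1]) • Qf mB mB mB := by
    funext ε
    have hε : sl ε = s' (⇑e8.symm ∘ ε) := by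
      rw [hs']
      congr 1
      funext p
      simp only [Function.comp_apply, Equiv.apply_symm_apply]
    simp only [Pi.add_apply, Pi.smul_apply, smul_eq_mul, hQf]
    rw [hε, hexp (⇑e8.symm ∘ ε)]
    simp only [Function.comp_apply]
  -- (ε) evaluation: `c = wordEval F yy sl`
  obtain ⟨yy, hyy⟩ : ∃ yy : Fin 8 → complexBetti X.X 1, ∀ a, yy a = avLetters ![𝟙 X] v (0, a) := ⟨_, fun _ => rfl⟩
  have hyyw : ∀ ε : Fin (2 * 2) → Fin 8, (fun p => avLetters ![𝟙 X] (⇑v) (u0 p, ε p)) = yy ∘ ε := fun ε => by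
    funext p; rw [Function.comp_apply, hyy, hu0]
  have hc_eval : c = wordEval F yy sl := by
    have hud : (default : Fin (2 * 2) → Fin 1) = u0 := Subsingleton.elim _ _
    rw [← hcax, wordEval_eq_sum_wordSlice, Fintype.sum_unique, hud, hslfun, wordEval_apply]
    exact Finset.sum_congr rfl fun ε _ => by rw [hyyw]
  have hperm : ∀ (f : (Fin (2 * 2) → Fin 8) → ℂ) (σ : Equiv.Perm (Fin (2 * 2))),
      wordEval F yy (fun ε => f (ε ∘ ⇑σ)) = ((Equiv.Perm.sign σ : ℤ) : ℂ) • wordEval F yy f :=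
    fun f σ => wordEval_precomp_perm F yy f σ
  have hS01 := SL2Cube.pairings_swap01 εf hεf mA mB mC hmA hmB hmC
  have hS12 := SL2Cube.pairings_swap12 εf hεf mA mB mC hmA hmB hmC
  set σ01 : Equiv.Perm (Fin 4) := Equiv.swap (0 : Fin 4) 1 with hσ01
  set σ12 : Equiv.Perm (Fin 4) := Equiv.swap (1 : Fin 4) 2 with hσ12
  have hsgn01 : ((Equiv.Perm.sign σ01 : ℤ) : ℂ) = -1 := by
    rw [hσ01, Equiv.Perm.sign_swap (by decide)]; norm_num
  have hsgn12 : ((Equiv.Perm.sign σ12 : ℤ) : ℂ) = -1 := by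
    rw [hσ12, Equiv.Perm.sign_swap (by decide)]; norm_num
  have hPl : ∀ u, mB u = mA u + mC u := fun u => by rw [hmA, hmB, hmC]; exact SL2Cube.pluecker εf hεf u
  have hPl3 : ∀ m m', Qf m m' mB = Qf m m' mA + Qf m m' mC := fun m m' => by
    funext ε; simp only [hQf, Pi.add_apply, hPl]; ring
  have hPl2 : ∀ m m', Qf m mB m' = Qf m mA m' + Qf m mC m' := fun m m' => by
    funext ε; simp only [hQf, Pi.add_apply, hPl]; ring
  have hPl1 : ∀ m m', Qf mB m m' = Qf mA m m' + Qf mC m m' := fun m m' => by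
    funext ε; simp only [hQf, Pi.add_apply, hPl]; ring
  have hcomp : ∀ (m m' m'' : (Fin 4 → Fin 2) → ℂ) (σ : Equiv.Perm (Fin 4)) (ε : Fin (2 * 2) → Fin 8),
      Qf m m' m'' (ε ∘ ⇑σ) = m ((fun p => e8.symm (ε p) 0) ∘ ⇑σ) * m' ((fun p => e8.symm (ε p) 1) ∘ ⇑σ) *
        m'' ((fun p => e8.symm (ε p) 2) ∘ ⇑σ) := fun m m' m'' σ ε => by rw [hQf]; rfl
  -- the Gram matrix `c₀ · Ω8` of `ψ_ℂ` in the letters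
  obtain ⟨Ω8, hΩ8⟩ : ∃ Ω8 : Matrix (Fin 8) (Fin 8) ℂ, ∀ a b, Ω8 a b = ∏ i, εf (e8.symm a i) (e8.symm b i) :=
    ⟨Matrix.of fun a b => ∏ i, εf (e8.symm a i) (e8.symm b i), fun _ _ => rfl⟩
  obtain ⟨c₀, hc₀def⟩ : ∃ c₀ : ℂ, c₀ = Ψ (cb fun _ => 0) (cb fun _ => 1) := ⟨_, rfl⟩
  have hskH : ∀ i u w, Ψ (Hh i u) w = -Ψ u (Hh i w) := fun i => formBaseChange_skew_of_mem_hodgeLieC ψ (hmem i).1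
  have hskE : ∀ i u w, Ψ (Ee i u) w = -Ψ u (Ee i w) := fun i => formBaseChange_skew_of_mem_hodgeLieC ψ (hmem i).2.1
  have hskF : ∀ i u w, Ψ (Ff i u) w = -Ψ u (Ff i w) := fun i => formBaseChange_skew_of_mem_hodgeLieC ψ (hmem i).2.2
  have hgram : ∀ a b, Ψ (cbσ a) (cbσ b) = c₀ * Ω8 a b := by
    intro a b
    rw [hcbσ, hcbσ, hGram Ψ hskH hskE hskF, hΩ8, hc₀def]
    congr 1
    exact Finset.prod_congr rfl fun i _ => by rw [hεf]
  have hΩt : ∀ a b, Ω8 b a = -Ω8 a b := fun a b => by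
    rw [hΩ8, hΩ8, Fin.prod_univ_three, Fin.prod_univ_three, SL2Cube.pairSign_swap εf hεf (e8.symm a 0),
      SL2Cube.pairSign_swap εf hεf (e8.symm a 1), SL2Cube.pairSign_swap εf hεf (e8.symm a 2)]
    ring
  have hΩΩ : ∀ j k, ∑ a, Ω8 a j * Ω8 a k = if j = k then (1 : ℂ) else 0 := by
    intro j k
    have h1 : ∑ a, Ω8 a j * Ω8 a k =
        ∑ x : Fin 3 → Fin 2, ∏ i, (εf (x i) (e8.symm j i) * εf (x i) (e8.symm k i)) := by
      rw [← Equiv.sum_comp e8.symm (fun x : Fin 3 → Fin 2 => ∏ i, (εf (x i) (e8.symm j i) * εf (x i) (e8.symm k i)))]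
      exact Finset.sum_congr rfl fun a _ => by rw [hΩ8, hΩ8, ← Finset.prod_mul_distrib]
    have h2 : (∑ x : Fin 3 → Fin 2, ∏ i, (εf (x i) (e8.symm j i) * εf (x i) (e8.symm k i))) =
        ∏ i : Fin 3, ∑ b : Fin 2, εf b (e8.symm j i) * εf b (e8.symm k i) := by
      rw [Finset.prod_univ_sum (fun _ : Fin 3 => (Finset.univ : Finset (Fin 2)))
        (fun i b => εf b (e8.symm j i) * εf b (e8.symm k i)), Fintype.piFinset_univ]
    rw [h1, h2, Finset.prod_congr rfl fun i _ => SL2Cube.sum_pairSign_mul_pairSign εf hεf (e8.symm j i) (e8.symm k i),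
      Finset.prod_boole]
    by_cases hjk : j = k
    · subst hjk; rw [if_pos (fun i _ => rfl), if_pos rfl]
    · rw [if_neg hjk, if_neg]
      intro hall
      exact hjk (e8.symm.injective (funext fun i => hall i (Finset.mem_univ i)))
  -- `c₀ ≠ 0`
  have hc₀ : c₀ ≠ 0 := by
    intro h0
    have hzero : ∀ a b, Ψ (cbσ a) (cbσ b) = 0 := fun a b => by rw [hgram, h0, zero_mul]
    have h : cbσ 0 = 0 := by
      refine ψ.eq_zero_of_forall_form_eq_zero' fun x => ?_
      rw [← cbσ.sum_repr x, map_sum, LinearMap.sum_apply]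
      exact Finset.sum_eq_zero fun a _ => by rw [map_smul, LinearMap.smul_apply, ← hΨ, hzero, smul_zero]
    exact cbσ.ne_zero 0 h
  -- the `ψ_ℂ`-dual family of `cbσ` and the Casimir class `Λ_ψ(1) = c₀⁻¹ φ'`
  obtain ⟨d', hd'⟩ : ∃ d' : Fin 8 → ℂ ⊗[ℚ] bettiCohomology X.X 1, ∀ j, d' j = ∑ a, (c₀⁻¹ * Ω8 a j) • cbσ a :=
    ⟨_, fun _ => rfl⟩
  have hdual' : ∀ j k, Ψ (d' j) (cbσ k) = if k = j then 1 else 0 := by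
    intro j k
    simp only [hd', map_sum, map_smul, LinearMap.sum_apply, LinearMap.smul_apply, smul_eq_mul, hgram]
    rw [show (∑ a, c₀⁻¹ * Ω8 a j * (c₀ * Ω8 a k)) = ∑ a, Ω8 a j * Ω8 a k from
      Finset.sum_congr rfl fun a _ => by rw [mul_mul_mul_comm, inv_mul_cancel₀ hc₀, one_mul], hΩΩ j k]
    by_cases h : j = k
    · subst h; rw [if_pos rfl]
    · rw [if_neg h, if_neg (Ne.symm h)]
  have hΩdet : Ω8.det ≠ 0 := by
    refine (Matrix.isUnit_det_of_left_inverse (B := Ω8ᵀ) ?_).ne_zero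
    ext j k
    rw [Matrix.mul_apply, Matrix.one_apply]
    simp only [Matrix.transpose_apply]
    exact hΩΩ j k
  have hsep : ∀ y, (∀ j, Ψ (d' j) y = 0) → y = 0 := by
    intro y hy
    have hvec : Matrix.vecMul (fun a => Ψ (cbσ a) y) Ω8 = 0 := by
      funext j
      have h := hy j
      simp only [hd', map_sum, map_smul, LinearMap.sum_apply, LinearMap.smul_apply, smul_eq_mul] at h
      rw [Finset.sum_congr rfl fun a _ => mul_assoc c₀⁻¹ (Ω8 a j) (Ψ (cbσ a) y), ← Finset.mul_sum] at h
      have h' := (mul_eq_zero.1 h).resolve_left (inv_ne_zero hc₀)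
      rw [Finset.sum_congr rfl fun a _ => mul_comm (Ω8 a j) (Ψ (cbσ a) y)] at h'
      exact h'
    have h0 := Matrix.eq_zero_of_vecMul_eq_zero hΩdet hvec
    have hb : ∀ a, Ψ (cbσ a) y = 0 := fun a => by
      have h := congr_fun h0 a
      simpa using h
    refine ψ.eq_zero_of_forall_form_eq_zero' fun x => ?_
    rw [← cbσ.sum_repr x, map_sum, LinearMap.sum_apply]
    exact Finset.sum_eq_zero fun a _ => by rw [map_smul, LinearMap.smul_apply, ← hΨ, hb, smul_zero]
  have hrat : IsRationalClass (casimirClass X ψ.form ψ.nondegenerate eQ 1) := by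
    have h := isRationalClass_casimirClass_baseChange ψ.form ψ.nondegenerate eQ 1
    rwa [LinearMap.baseChange_one] at h
  have hcas : casimirClass X ψ.form ψ.nondegenerate eQ 1 = c₀⁻¹ • ∑ a, ∑ b, Ω8 a b • cupH1 X (cbσ a) (cbσ b) := by
    rw [casimirClass_apply, sum_dual_eq_sum_dual Ψ (cupH1 X) _ _
      (eq_sum_formBaseChange_smul_dualBasis ψ.form ψ.nondegenerate eQ) (⇑cbσ) d' hdual' hsep 1]
    simp only [Finset.smul_sum, smul_smul]
    rw [Finset.sum_comm]
    refine Finset.sum_congr rfl fun b _ => ?_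
    simp only [hd', Module.End.one_apply, map_sum, map_smul, LinearMap.sum_apply, LinearMap.smul_apply]
  -- `φ' = ∑ Ω8_{ab} cbσ_a ⌣ cbσ_b` is a combination of rational `(1,1)`-classes
  have hcup := BettiUniverse.cupPreservesHodgeType hHD hI hX
  obtain ⟨Mh⟩ := nonempty_hodgeModel_holds hX
  have hΩkind : ∀ a b, κ' a = κ' b → Ω8 a b = 0 := by
    intro a b hab
    rw [hΩ8]
    exact Finset.prod_eq_zero (Finset.mem_univ (0 : Fin 3)) (by rw [hεf, ← hκ', ← hκ', if_pos hab])
  have htype : IsOfHodgeType X.dim X.X 2 1 1 (∑ a, ∑ b, Ω8 a b • cupH1 X (cbσ a) (cbσ b)) := by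
    refine IsOfHodgeType.sum hX Mh _ _ fun a _ => IsOfHodgeType.sum hX Mh _ _ fun b _ => ?_
    rcases hcase (κ' a) with ha | ha <;> rcases hcase (κ' b) with hb | hb
    · rw [hΩkind a b (ha.trans hb.symm), zero_smul]
      exact IsOfHodgeType.zero Mh 2 1 1
    · refine IsOfHodgeType.smul ?_ _
      rw [cupH1_apply]
      have ha' := (BettiUniverse.mem_hodge_piece_iff hHD hI hX (k := 1) (p := 1) (q := 0) rfl _).1 (hkind0 a ha)
      have hb' := (BettiUniverse.mem_hodge_piece_iff hHD hI hX (k := 1) (p := 0) (q := 1) rfl _).1 (hkind1 b hb)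
      have h' : IsOfHodgeType X.dim X.X 2 (1 + 0) (0 + 1) _ := hcup (rfl : 1 + 1 = 2) ha' hb'
      exact h'
    · refine IsOfHodgeType.smul ?_ _
      rw [cupH1_apply]
      have ha' := (BettiUniverse.mem_hodge_piece_iff hHD hI hX (k := 1) (p := 0) (q := 1) rfl _).1 (hkind1 a ha)
      have hb' := (BettiUniverse.mem_hodge_piece_iff hHD hI hX (k := 1) (p := 1) (q := 0) rfl _).1 (hkind0 b hb)
      have h' : IsOfHodgeType X.dim X.X 2 (0 + 1) (1 + 0) _ := hcup (rfl : 1 + 1 = 2) ha' hb'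
      exact h'
    · rw [hΩkind a b (ha.trans hb.symm), zero_smul]
      exact IsOfHodgeType.zero Mh 2 1 1
  have hθmem : (∑ a, ∑ b, Ω8 a b • cupProduct (rfl : 1 + 1 = 2) (v a) (v b)) ∈
      Submodule.span ℂ {c : complexBetti X.X 2 | IsRationalClass c ∧ IsOfHodgeType X.dim X.X 2 1 1 c} := by
    have hθeq : (∑ a, ∑ b, Ω8 a b • cupProduct (rfl : 1 + 1 = 2) (v a) (v b)) =
        c₀ • casimirClass X ψ.form ψ.nondegenerate eQ 1 := by
      rw [hcas, smul_smul, mul_inv_cancel₀ hc₀, one_smul]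
      simp only [cupH1_apply, hv_apply]
    rw [hθeq]
    refine Submodule.smul_mem _ _ (Submodule.subset_span ⟨hrat, ?_⟩)
    rw [hcas]
    exact IsOfHodgeType.smul htype _
  -- the base evaluation: `wordEval F yy (Qf A A A) = φ'' ⌣ φ'' ∈ D²` (Milne)
  have hpair : ∀ (I J : Fin 2 → Fin 1) (cc : Fin 2),
      (∑ a, ∑ a', Ω8 a a' • cupProduct (rfl : 1 + 1 = 2) (avLetters ![𝟙 X] (⇑v) (I cc, a))
        (avLetters ![𝟙 X] (⇑v) (J cc, a'))) ∈
      Submodule.span ℂ {b : complexBetti X.X 2 | IsRationalClass b ∧ IsOfHodgeType X.dim X.X 2 1 1 b} := by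
    intro I J cc
    simp only [avLetters_apply]
    exact Milne1999.sum_smul_cross_mem_span_rational_oneOne _ _ (⇑v) Ω8 hΩt hθmem
  obtain ⟨e₀, he₀⟩ : ∃ e₀ : Fin (2 * 2) ≃ Fin 2 × Fin 2, ∀ r cc, e₀.symm (r, cc) = posEquiv 2 (cc, r) :=
    ⟨(posEquiv 2).symm.trans (Equiv.prodComm (Fin 2) (Fin 2)), fun _ _ => rfl⟩
  have hp00 : e₀.symm (0, 0) = (0 : Fin 4) := by rw [he₀]; decide
  have hp10 : e₀.symm (1, 0) = (1 : Fin 4) := by rw [he₀]; decide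
  have hp01 : e₀.symm (0, 1) = (2 : Fin 4) := by rw [he₀]; decide
  have hp11 : e₀.symm (1, 1) = (3 : Fin 4) := by rw [he₀]; decide
  have hTAAA : wordEval F yy (Qf mA mA mA) ∈ divisorClassesSpan X.X X.dim 2 := by
    obtain ⟨π, hπ, hsum⟩ := Milne1999.sum_completeContraction_smul_eq F Ω8 e₀ (avLetters ![𝟙 X] (⇑v)) u0
    have hπ1 : π = 1 := by
      refine Equiv.ext fun qq => ?_
      obtain ⟨⟨cc, r⟩, rfl⟩ := (posEquiv 2).surjective qq
      rw [hπ, he₀]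
      rfl
    have hcc : ∀ ε : Fin (2 * 2) → Fin 8, Qf mA mA mA ε = completeContraction Ω8 e₀ ε := by
      intro ε
      rw [completeContraction_apply, Fin.prod_univ_two, hp00, hp10, hp01, hp11, hQf, hmA, hmA, hmA, hΩ8, hΩ8,
        Fin.prod_univ_three, Fin.prod_univ_three]
      ring
    rw [wordEval_apply, show (∑ ε, Qf mA mA mA ε • F (yy ∘ ε)) =
      ∑ ε, completeContraction Ω8 e₀ ε • F (fun qq => avLetters ![𝟙 X] (⇑v) (u0 qq, ε qq)) from
        Finset.sum_congr rfl fun ε _ => by rw [hcc, hyyw], hsum, hπ1, Equiv.Perm.sign_one, Units.val_one,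
      Int.cast_one, one_smul]
    simp_rw [hFdef, cupPowOneAlt_apply]
    exact Milne1999.sum_smul_cupPowOne_spPairWord_mem Ω8 _ 2 _ _ (hpair _ _)
  -- the other seven evaluations: alternation and Plücker
  have hsolve : ∀ {x y : complexBetti X.X (2 * 2)}, y ∈ divisorClassesSpan X.X X.dim 2 →
      x = y + (-1 : ℂ) • x → x ∈ divisorClassesSpan X.X X.dim 2 := by
    intro x y hy h
    rw [neg_one_smul, eq_add_neg_iff_add_eq] at h
    have hx : x = (2 : ℂ)⁻¹ • y := by
      rw [← h, ← two_smul ℂ x, smul_smul, inv_mul_cancel₀ (two_ne_zero' ℂ), one_smul]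
    rw [hx]
    exact Submodule.smul_mem _ _ hy
  have hAAC : Qf mA mA mC = fun ε => Qf mA mA mB (ε ∘ ⇑σ01) := by
    funext ε; rw [hcomp, (hS01 _).1, (hS01 _).1, (hS01 _).2.1, hQf]; ring
  have hTAAB : wordEval F yy (Qf mA mA mB) ∈ divisorClassesSpan X.X X.dim 2 :=
    hsolve hTAAA (by conv_lhs => rw [hPl3 mA mA, map_add, hAAC, hperm (Qf mA mA mB) σ01, hsgn01])
  have hACA : Qf mA mC mA = fun ε => Qf mA mB mA (ε ∘ ⇑σ01) := by
    funext ε; rw [hcomp, (hS01 _).1, (hS01 _).2.1, (hS01 _).1, hQf]; ring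
  have hTABA : wordEval F yy (Qf mA mB mA) ∈ divisorClassesSpan X.X X.dim 2 :=
    hsolve hTAAA (by conv_lhs => rw [hPl2 mA mA, map_add, hACA, hperm (Qf mA mB mA) σ01, hsgn01])
  have hCAA : Qf mC mA mA = fun ε => Qf mB mA mA (ε ∘ ⇑σ01) := by
    funext ε; rw [hcomp, (hS01 _).2.1, (hS01 _).1, (hS01 _).1, hQf]; ring
  have hTBAA : wordEval F yy (Qf mB mA mA) ∈ divisorClassesSpan X.X X.dim 2 :=
    hsolve hTAAA (by conv_lhs => rw [hPl1 mA mA, map_add, hCAA, hperm (Qf mB mA mA) σ01, hsgn01])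
  have hABB : Qf mA mB mB = fun ε => Qf mB mA mA (ε ∘ ⇑σ12) := by
    funext ε; rw [hcomp, (hS12 _).2.1, (hS12 _).1, (hS12 _).1, hQf]
  have hTABB : wordEval F yy (Qf mA mB mB) ∈ divisorClassesSpan X.X X.dim 2 := by
    rw [hABB, hperm (Qf mB mA mA) σ12, hsgn12]; exact Submodule.smul_mem _ _ hTBAA
  have hBAB : Qf mB mA mB = fun ε => Qf mA mB mA (ε ∘ ⇑σ12) := by
    funext ε; rw [hcomp, (hS12 _).1, (hS12 _).2.1, (hS12 _).1, hQf]
  have hTBAB : wordEval F yy (Qf mB mA mB) ∈ divisorClassesSpan X.X X.dim 2 := by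
    rw [hBAB, hperm (Qf mA mB mA) σ12, hsgn12]; exact Submodule.smul_mem _ _ hTABA
  have hBBA : Qf mB mB mA = fun ε => Qf mA mA mB (ε ∘ ⇑σ12) := by
    funext ε; rw [hcomp, (hS12 _).1, (hS12 _).1, (hS12 _).2.1, hQf]
  have hTBBA : wordEval F yy (Qf mB mB mA) ∈ divisorClassesSpan X.X X.dim 2 := by
    rw [hBBA, hperm (Qf mA mA mB) σ12, hsgn12]; exact Submodule.smul_mem _ _ hTAAB
  have hBBB : Qf mB mB mB = fun ε => Qf mA mA mA (ε ∘ ⇑σ12) := by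
    funext ε; rw [hcomp, (hS12 _).1, (hS12 _).1, (hS12 _).1, hQf]
  have hTBBB : wordEval F yy (Qf mB mB mB) ∈ divisorClassesSpan X.X X.dim 2 := by
    rw [hBBB, hperm (Qf mA mA mA) σ12, hsgn12]; exact Submodule.smul_mem _ _ hTAAA
  -- conclusion
  rw [hc_eval, hsl_exp]
  simp only [map_add, map_smul]
  exact Submodule.add_mem _ (Submodule.add_mem _ (Submodule.add_mem _ (Submodule.add_mem _ (Submodule.add_mem _
    (Submodule.add_mem _ (Submodule.add_mem _ (Submodule.smul_mem _ _ hTAAA) (Submodule.smul_mem _ _ hTAAB))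
    (Submodule.smul_mem _ _ hTABA)) (Submodule.smul_mem _ _ hTABB)) (Submodule.smul_mem _ _ hTBAA))
    (Submodule.smul_mem _ _ hTBAB)) (Submodule.smul_mem _ _ hTBBA)) (Submodule.smul_mem _ _ hTBBB)

end SL2Cubed

/-! ### §3 Every complex abelian fourfold with `End⁰(X) = ℚ`: `B²(X) ⊆ D²(X) ⊗ ℂ` and the Hodge conjecture -/

section Fourfold

open Literature.AlgebraicTopology.SingularHomology
open Literature.AlgebraicGeometry.Motives (IsSmoothProjective AbelianVariety bettiCohomology
  ofRatClassBaseChange ofRatClassBaseChange_tmul HodgeTensorFacts hodgeTensorFacts_holds)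
open Literature.Barriers.HodgeConjecture
open Literature.AlgebraicGeometry.Motives.HodgeStructure
open Literature.RepresentationTheory.GeneralLinear
open Literature.NumberTheory.DiophantineGeometry

variable {X : AbelianVariety ℂ}

/-- **`B²(X) ⊆ D²(X) ⊗ ℂ` FOR EVERY COMPLEX ABELIAN FOURFOLD WITH `finrank_ℚ End⁰(X) = 1`** (Moonen–Zarhin 1999 Thm. (0.1)(3):
«Suppose we are in case (d). Then the Hodge ring `B•(X)` is generated by divisor classes … Either `Hg(X) = Sp(V,φ)` … or `Hg(X)` is
isogenous to a `ℚ`-form of `SL₂ × SL₂ × SL₂`», (2.5)(1) «In both cases the Hodge ring of `X` is generated by divisor classes»), in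
codimension two, UNCONDITIONALLY (`hHD`, `hI` the tree's real-Hodge-model hypotheses, `ψ` a polarization of `H¹`).  PROOF:
`dim_ℚ H¹ = 8`, `End_Hdg(H¹) = ℚ` (`exists_eq_smul_one_of_finrank_endAlgebra_eq_one`); by `hodgeLieC_rankEight_dichotomy` either
`Lie Hg ⊗ ℂ ∋` every `ψ_ℂ`-skew operator — then `AVSlots.isDivisorGenerated_of_hodgeLieC_sp` — or the Mumford position, put in
normal form by `exists_mumford_normalForm` and fed to `mem_divisorClassesSpan_two_of_sl2Triples`.
[cite: MoonenZarhin1999LowDim, Thm. (0.1)(3), §1 (1.8) and §2 (2.5)(1)] [cite: MoonenZarhin1995Duke, §2 (type I(1))]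
[cite: Mumford1969NoteShimura, §4] -/
theorem mem_divisorClassesSpan_two_of_finrank_endAlgebra_eq_one_of_dim_eq_four [HodgeTensorFacts.{0, 0}]
    (hHD : exists_isReal_hodgeModel) (hI : hodgePQ_independent_of_hodgeModel)
    (h1 : Module.finrank ℚ X.endAlgebra = 1) (h4 : X.dim = 4)
    (ψ : (BettiUniverse.hodge hHD (AbelianVariety.isSmoothProjective_holds (A := X)) 1).Polarization)
    {c : complexBetti X.X (2 * 2)} (hcQ : IsRationalClass c) (hc : IsOfHodgeType X.dim X.X (2 * 2) 2 2 c) :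
    c ∈ divisorClassesSpan X.X X.dim 2 := by
  haveI : Module.Finite ℚ (bettiCohomology X.X 1) := finite_bettiCohomology_one X
  have hX : IsSmoothProjective X.dim X.X := AbelianVariety.isSmoothProjective_holds
  have heff := BettiUniverse.hodge_isEffective hHD hX 1
  have hV : Module.finrank ℚ (bettiCohomology X.X 1) = 8 := by rw [finrank_bettiCohomology_one X, h4]
  have hE := exists_eq_smul_one_of_finrank_endAlgebra_eq_one hHD hI h1 (by omega)
  rcases hodgeLieC_rankEight_dichotomy (BettiUniverse.hodge hHD (AbelianVariety.isSmoothProjective_holds (A := X)) 1)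
      Nat.cast_one heff ψ hE hV with hsp | hmum
  · exact (avSlots_self X).isDivisorGenerated_of_hodgeLieC_sp hHD hI ψ hsp 2 c hcQ hc
  · obtain ⟨Θ, B₀, C₀, μ₀, hΘ, -, hB₀𝔥, -, hB₀0, hB₀P, hB₀im, hC₀, -, -, hμ₀, -, hBC, hCB, hline, hline',
      W, C, hWle, hCle, -, hWC, hW3, hWst, hCst, hcommWC, hW𝔰⟩ := hmum
    obtain ⟨Hh, Ee, Ff, hH0, -, -, hmem, hstd, hcomm, -⟩ :=
      exists_mumford_normalForm (BettiUniverse.hodge hHD (AbelianVariety.isSmoothProjective_holds (A := X)) 1) ψ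
        Nat.cast_one heff hV hΘ hB₀𝔥 hB₀0 hB₀P hB₀im hC₀ hμ₀ hBC hCB hline hline' hE hWle hCle hWC hW3 hWst hCst
        hcommWC hW𝔰
    exact mem_divisorClassesSpan_two_of_sl2Triples hHD hI ψ hV Hh Ee Ff (by rw [hH0]; exact hΘ) hmem hstd hcomm hcQ hc

/-- **`B•(X) = D•(X) ⊗ ℂ` IN ALL CODIMENSIONS (`IsDivisorGenerated X`) for EVERY complex abelian fourfold with
`finrank_ℚ End⁰(X) = 1`** — Moonen–Zarhin Thm. (0.1)(3) as printed, «Then the Hodge ring `B•(X)` is generated by divisor classes,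
i.e., `B•(X) = D•(X)`»: codimensions `0, 1` are free and `3, 4` follow from `1, 0` by hard Lefschetz
(`isDivisorGenerated_of_dim_le_five_of_codimTwo`), codimension `2` is
`mem_divisorClassesSpan_two_of_finrank_endAlgebra_eq_one_of_dim_eq_four`.  UNCONDITIONAL.
[cite: MoonenZarhin1999LowDim, Thm. (0.1)(3) and Introduction (p. 711)] [cite: VoisinHodgeI2002, Thm. 6.25 and Rem. 6.27] -/
theorem isDivisorGenerated_of_finrank_endAlgebra_eq_one_of_dim_eq_four [HodgeTensorFacts.{0, 0}]
    (hHD : exists_isReal_hodgeModel) (hI : hodgePQ_independent_of_hodgeModel)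
    (h1 : Module.finrank ℚ X.endAlgebra = 1) (h4 : X.dim = 4)
    (ψ : (BettiUniverse.hodge hHD (AbelianVariety.isSmoothProjective_holds (A := X)) 1).Polarization) :
    IsDivisorGenerated X :=
  isDivisorGenerated_of_dim_le_five_of_codimTwo X (by omega) fun _ hcQ hc =>
    mem_divisorClassesSpan_two_of_finrank_endAlgebra_eq_one_of_dim_eq_four hHD hI h1 h4 ψ hcQ hc

/-- **`IsCodimTwoDivisorWeilGenerated X` (`B²(X) ⊆ D²(X) + Σ W_K`, the Weil summand not needed) for EVERY complex abelian
fourfold with `finrank_ℚ End⁰(X) = 1`** — the row I(1) of Moonen–Zarhin's fourfold table, both branches, UNCONDITIONALLY.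
[cite: MoonenZarhin1999LowDim, Thm. 0.1, Thm. (0.1)(3) and §2 (2.5)(1)] [cite: MoonenZarhin1995Duke, §2 (type I(1))] -/
theorem isCodimTwoDivisorWeilGenerated_of_finrank_endAlgebra_eq_one_of_dim_eq_four [HodgeTensorFacts.{0, 0}]
    (hHD : exists_isReal_hodgeModel) (hI : hodgePQ_independent_of_hodgeModel)
    (h1 : Module.finrank ℚ X.endAlgebra = 1) (h4 : X.dim = 4)
    (ψ : (BettiUniverse.hodge hHD (AbelianVariety.isSmoothProjective_holds (A := X)) 1).Polarization) :
    IsCodimTwoDivisorWeilGenerated X :=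
  fun _ hcQ hc =>
    Submodule.mem_sup_left (mem_divisorClassesSpan_two_of_finrank_endAlgebra_eq_one_of_dim_eq_four hHD hI h1 h4 ψ hcQ hc)

/-- **THE HODGE CONJECTURE FOR EVERY COMPLEX ABELIAN FOURFOLD WITH `finrank_ℚ End⁰(X) = 1` — UNCONDITIONAL** (no `HC_CM`, no
Markman): `HC(X) ⟺ HC²(X)` for a fourfold (`hodgeConjectureFor_iff_codim_two_of_dim_eq_four`), rational `(2,2)`-classes lie in
`D²(X) ⊗ ℂ` (`mem_divisorClassesSpan_two_of_finrank_endAlgebra_eq_one_of_dim_eq_four`), and products of divisor classes are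
algebraic (Lefschetz `(1,1)`, `lefschetzOneOne_rational_holds`; `AbelianVariety.divisorClassesSpan_le_algebraicClasses`).  MZ99
Thm. (0.1)(3), case (d): «Then the Hodge ring `B•(X)` is generated by divisor classes»; van Geemen §2.4: «if `Dᵖ = Bᵖ`, then the
Hodge `(p,p)`-conjecture is true».  [cite: MoonenZarhin1999LowDim, Thm. (0.1)(3) and §2 (2.5)(1)] [cite: vanGeemen1994HodgeAV, §2.4]
[cite: VoisinHodgeI2002, Thm. 11.30 and §11.3.1] -/
theorem hodgeConjectureFor_of_finrank_endAlgebra_eq_one_of_dim_eq_four [HodgeTensorFacts.{0, 0}]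
    (hHD : exists_isReal_hodgeModel) (hI : hodgePQ_independent_of_hodgeModel)
    (h1 : Module.finrank ℚ X.endAlgebra = 1) (h4 : X.dim = 4)
    (ψ : (BettiUniverse.hodge hHD (AbelianVariety.isSmoothProjective_holds (A := X)) 1).Polarization) :
    HodgeConjectureFor X.dim X.X := by
  have hX : IsSmoothProjective X.dim X.X := AbelianVariety.isSmoothProjective_holds
  have hX4 : IsSmoothProjective 4 X.X := h4 ▸ hX
  rw [h4, hodgeConjectureFor_iff_codim_two_of_dim_eq_four hX4]
  intro c hcQ hc
  have hc' : IsOfHodgeType X.dim X.X (2 * 2) 2 2 c := by rw [h4]; exact hc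
  exact AbelianVariety.divisorClassesSpan_le_algebraicClasses X
    (fun b hb hb' => lefschetzOneOne_rational_holds hX b hb hb') 2
    (mem_divisorClassesSpan_two_of_finrank_endAlgebra_eq_one_of_dim_eq_four hHD hI h1 h4 ψ hcQ hc')

end Fourfold

end Literature.AlgebraicGeometry.HodgeTheory

end
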